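import Summits.QuantumFields.YangMills.Theorems.FluctuationComparisonRegPrIntLS2BetaChartReadDerivCovLinAvg
import Summits.QuantumFields.YangMills.Theorems.FluctuationComparisonRegPrIntLS2BetaChartReadDerivStructure
import HarnessLib

/-!
# S2β · (D2) «WHAT `DM` DOES, k STEPS, IN SUP NORM»: `‖↑((DΨ_k(0) X) B)‖ ≤ (1 + 4(d+2))·Π_{i<k}(1 + c₃·α_i)·L^k·‖X‖_∞ ≤ (1 + 4(d+2))·e^{c₃·Σα_i}·L^k·‖X‖_∞`
# — the constant is INDEPENDENT OF `k` once `Σ_{i<k} α_i` is bounded (the ONE analytic brick of px16 g21's (RINV-curl) road «preimages by gauge-family face spreads», bus 13:44:05Z)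

Cell `ym3-torus` (YM ladder rung R3 = continuum `SU(2)` Yang–Mills on the three-torus at fixed lattice data — a RUNG: NOT d = 4, NOT infinite volume, NOT a mass gap,
NOT Clay).  Width seat `ym3-torus-px13` (gen 25); crux `stmt-QuantumFields-20520`, LINE g18-1 S2β; letter MULT♮ ⟸ (RINV-curl) ∧ BKG (✓p824141), (RINV-curl) ⟸ (B1)(B2)(B4)(B5)
(px16 g21) + **(D2)** (this file).  `--kind proof --supports stmt-QuantumFields-20520 --as helper`, count-neutral, DEFINITION-FREE (0 `def`, 0 `instance`, 0 `notation`, 0 `sorry`);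
generic `P : Params`, `SU(N)`.

THE BOOTSTRAP ([Balaban1985Averaging] (139)–(147) pp.39–40 «|Q_k(U₀)A| ≤ (1+2C₁α₀)Q̄′_k|A|» for the axial-gauge operator, re-done for the gauge-invariant (0.4) reading where the stair
terms are first order and travel as coarse covariant gradients).  With `V_i = Ū^i U₀`, `Y_i := ↑(DΨ_i(0) X)` (matrix-valued), (D0) ✓p824574 + (D1) ✓p824693 give
`Y_{i+1} = Q₁^{R₀}(V_i)Y_i + R_i`, `‖R_i‖_∞ ≤ 404ℓα_i‖Y_i‖_∞`; maintain `Y_i = M_i + D_{V_i}Φ_i` with ✓F1 `…ChartReadDerivStructure`: (s2′) `Q₁^{R₀}(V)M = LM_V(M) + D_{Ū V}(SM_V(M)) + e`,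
(s1′) `Q₁^{R₀}(V)(D_VΦ) = D_{ŪV}(Φ∘emb) + e′` ⟹ `Φ_{i+1} := SM_{V_i}(M_i) + Φ_i∘emb`, `M_{i+1} :=` the rest; sup norms `m_{i+1} ≤ (L + α_i(6 + 404)(d+2)L)m_i + α_i(6 + 808(d+2)L)φ_i`,
`φ_{i+1} ≤ (d+2)L·m_i + φ_i` ⟹ `m_i ≤ E_i·L^i·‖X‖`, `φ_i ≤ 2(d+2)·E_i·L^i·‖X‖`, `E_i = Π_{j<i}(1 + c₃α_j)`, **`c₃ := (d+2)·(422 + 1616·(d+2))`** (for `L ≥ 2`), and finally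
`‖Y_k(B)‖ ≤ m_k + 2φ_k`.

WHAT IS PROVED (sorry-free).
* §1 letters: `norm_coe_comp_eq` (`‖↑∘X‖_∞ = ‖X‖_∞`), `prod_one_add_nonneg_mono`∕`one_le_prod_one_add` (the envelope `E_i`), `prod_one_add_le_exp_sum`.
* §2 ★★`exists_decomp_fderiv_chartRead_iter` — for every `i ≤ k`: `∃ M Φ, (∀ b, ↑((DΨ_i(0)X) b) = M b + (Φ b₋ − V_i b·Φ b₊·V_i b*)) ∧ ‖M‖ ≤ E_i L^i ‖X‖ ∧ ‖Φ‖ ≤ 2(d+2)E_i L^i ‖X‖`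
  under the loop `α_i`-guards at every level `i < k` (`α_i ≤ 1∕24`, `α_i < δ_N`).
* §3 ★★★`norm_fderiv_chartRead_iter_apply_le` — **`‖↑((DΨ_k(0) X) B)‖ ≤ (1 + 4(d+2))·(Π_{i<k}(1 + c₃α_i))·L^k·‖X‖_∞`**; ★★★`norm_fderiv_chartRead_iter_apply_le_exp` — the same with
  `exp(c₃·Σ_{i<k}α_i)`: the (D2) letter with `A = (1 + 4(d+2))·e^{c₃Σα}`, INDEPENDENT of `k`.

HONEST.  Real-analysis bookkeeping over (D0)(D1) and F1; the constants are crude (stair length `(d+2)L`, no optimisation) but k-free and L-free given `Σα`; nothing of Bałaban's beyond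
the printed Prop. 3 already in the tree; (RINV-curl) itself ((B1)(B2)(B4)(B5), the face spreads, the 3×3 Neumann, the door into ✓p824141) is px16 g21's pen and is NOT here; MULT♮,
AVG₂♭, «CRIT-ax», (D-ax), GAP♯∘ (registry UNTOUCHED), the five REGISTERED stubs, S2β, crux 20520, 19936, 19200 and `YM3TorusSU2` are NOT proved; no summit statement is proved by a
helper; rung R3 = SU(2) YM₃ on T³ at fixed lattice data — NOT d = 4, NOT infinite volume, NOT a mass gap, NOT Clay; the Yang–Mills mass gap is NOT proved.  Axioms standard.

References: T. Bałaban, CMP **98** (1985) 17–51 [Balaban1985Averaging] (Prop. 3 (121)–(126) p.36, Prop. 4 p.37, (139)–(147) pp.39–40); CMP **109** (1987) 249–301 [Balaban1987RG1]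
((0.4), (0.8), (0.11) p.253).
-/

set_option autoImplicit false

noncomputable section

open scoped BigOperators Matrix.Norms.L2Operator Topology
open Filter Set Function

namespace Summit.QuantumFields.YangMills.Theorems.FluctuationComparisonRegPrIntLS2BetaChartReadDerivKStepSup

open Literature.MathematicalPhysics.QuantumFieldTheory.Balaban1983to89
open Literature.MathematicalPhysics.QuantumFieldTheory.Balaban1983to89.T4Continuum
open Literature.MathematicalPhysics.QuantumFieldTheory.Balaban1983to89.HaarExponentialChart
open Literature.MathematicalPhysics.QuantumFieldTheory.Balaban1983to89.HaarExponentialChart.IsChartRep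
open Literature.MathematicalPhysics.QuantumFieldTheory.Balaban1983to89.BlockAveraging
open Literature.MathematicalPhysics.QuantumFieldTheory.Balaban1983to89.AveragingRT
open Literature.MathematicalPhysics.QuantumFieldTheory.Balaban1983to89.ExpMeanLog (expMeanLogSU deltaSU)
open Literature.MathematicalPhysics.QuantumFieldTheory.Balaban1983to89.Node00
open Literature.MathematicalPhysics.QuantumFieldTheory.Balaban1983to89.BlockAveragingEMLLinearised
open Literature.MathematicalPhysics.QuantumFieldTheory.Balaban1983to89.BlockAveragingEMLLinearisedBackground
  (covWalkSum covLinAvgR0 covLinAvgR0_add)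
open Summit.QuantumFields.YangMills.BalabanUVNodes.N09ChartReadAveragingSmooth
open Summit.QuantumFields.YangMills.Theorems.Prop7HolRatioPerStep (norm_coe_eq_one norm_star_coe_eq_one norm_mean_le')
open Summit.QuantumFields.YangMills.Theorems.FluctuationComparisonRegPrIntLS2BetaChartReadDescentOnto (smallBelow_of_loopGuard)
open Summit.QuantumFields.YangMills.Theorems.FluctuationComparisonRegPrIntLS2BetaChartReadDescentChainRule (fderiv_chartRead_iter_succ_apply fderiv_chartRead_iter_zero)
open Summit.QuantumFields.YangMills.Theorems.FluctuationComparisonRegPrIntLS2BetaChartReadDerivCovLinAvg (norm_fderiv_chartRead_sub_covLinAvgR0_le)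
open Summit.QuantumFields.YangMills.Theorems.FluctuationComparisonRegPrIntLS2BetaChartReadDerivStructure
  (norm_stairMean_le norm_lineMean_le norm_covGrad_le norm_covLinAvgR0_sub_structure_avgFun_le norm_covLinAvgR0_covGrad_sub_le)

variable {P : Params} {N : ℕ} [NeZero N]

/-! ## §1 Letters: the sup norm through the coercion; the envelope `E_i = Π_{j<i}(1 + c·α_j)` -/

section Letters

/-- The sup norm of a chart field equals the sup norm of its matrix coercion. [folklore] -/
theorem norm_coe_comp_eq {ι : Type*} [Fintype ι] (X : ι → (specialUnitaryLogChart (Fin N)).lie) :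
    ‖(fun b => ((X b : (specialUnitaryLogChart (Fin N)).lie) : Matrix (Fin N) (Fin N) ℂ))‖ = ‖X‖ := by
  apply le_antisymm
  · refine (pi_norm_le_iff_of_nonneg (norm_nonneg X)).2 fun b => ?_
    calc ‖((X b : (specialUnitaryLogChart (Fin N)).lie) : Matrix (Fin N) (Fin N) ℂ)‖ = ‖X b‖ := Submodule.norm_coe (X b)
      _ ≤ ‖X‖ := norm_le_pi_norm X b
  · refine (pi_norm_le_iff_of_nonneg (norm_nonneg _)).2 fun b => ?_
    calc ‖X b‖ = ‖((X b : (specialUnitaryLogChart (Fin N)).lie) : Matrix (Fin N) (Fin N) ℂ)‖ := (Submodule.norm_coe (X b)).symm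
      _ ≤ ‖(fun b => ((X b : (specialUnitaryLogChart (Fin N)).lie) : Matrix (Fin N) (Fin N) ℂ))‖ :=
          norm_le_pi_norm (fun b => ((X b : (specialUnitaryLogChart (Fin N)).lie) : Matrix (Fin N) (Fin N) ℂ)) b

/-- `1 ≤ Π_{j<i}(1 + c·α_j)` for `c, α_j ≥ 0`. [folklore] -/
theorem one_le_prod_one_add {c : ℝ} (hc : 0 ≤ c) {α : ℕ → ℝ} (hα : ∀ j, 0 ≤ α j) (i : ℕ) :
    1 ≤ ∏ j ∈ Finset.range i, (1 + c * α j) :=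
  Finset.one_le_prod fun j _ => le_add_of_nonneg_right (mul_nonneg hc (hα j))

/-- The envelope is monotone: `Π_{j<i}(1 + cα_j) ≤ Π_{j<i+1}(1 + cα_j)`. [folklore] -/
theorem prod_one_add_le_succ {c : ℝ} (hc : 0 ≤ c) {α : ℕ → ℝ} (hα : ∀ j, 0 ≤ α j) (i : ℕ) :
    ∏ j ∈ Finset.range i, (1 + c * α j) ≤ ∏ j ∈ Finset.range (i + 1), (1 + c * α j) := by
  rw [Finset.prod_range_succ]
  have h1 : 0 ≤ ∏ j ∈ Finset.range i, (1 + c * α j) := (zero_le_one.trans (one_le_prod_one_add hc hα i))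
  nlinarith [mul_nonneg hc (hα i)]

/-- `Π_{j<k}(1 + cα_j) ≤ exp(c·Σ_{j<k}α_j)` (`1 + x ≤ e^x`). [folklore] -/
theorem prod_one_add_le_exp_sum {c : ℝ} (hc : 0 ≤ c) {α : ℕ → ℝ} (hα : ∀ j, 0 ≤ α j) (k : ℕ) :
    ∏ j ∈ Finset.range k, (1 + c * α j) ≤ Real.exp (c * ∑ j ∈ Finset.range k, α j) := by
  rw [Finset.mul_sum, Real.exp_sum]
  exact Finset.prod_le_prod (fun j _ => by nlinarith [mul_nonneg hc (hα j)]) fun j _ => by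
    have := Real.add_one_le_exp (c * α j); linarith

end Letters

/-! ## §2 One step of the decomposition (pure algebra over F1), then the bootstrap along the levels -/

section Step

/-- ★ **ONE STEP OF THE DECOMPOSITION** (no derivatives: F1's (s1′)(s2′) + the triangle inequality).  If `Y = M + D_VΦ` at level `i`, the loop variables of `V` are within `α`
of `1` (`α ≤ 1∕6`, `α < δ_N`), and `Y′` at level `i+1` satisfies `‖Y′(c) − Q₁^{R₀}(V)Y(c)‖ ≤ r·‖Y‖`, then `Y′ = M′ + D_{Ū V}Φ′` with `Φ′ := SM_V(M) + Φ∘emb`,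
`‖M′‖ ≤ (L + 6α(d+2)L + r)·‖M‖ + (6α + 2r)·‖Φ‖`, `‖Φ′‖ ≤ (d+2)L·‖M‖ + ‖Φ‖`. [cite: Balaban1985Averaging, Prop. 3 (124)-(126) p.36, (139)-(147) pp.39-40] -/
theorem decomp_step {i : ℕ} (V : GaugeField P i (SU N)) {α r : ℝ} (hα : ∀ (c : PBond P (i + 1)) (idx : Idx P), dist1 (loopHol V c idx) ≤ α)
    (hαδ : α < deltaSU (Fin N)) (hα6 : α ≤ 1 / 6) (hα0 : 0 ≤ α) (hr : 0 ≤ r)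
    (Y M : PBond P i → Matrix (Fin N) (Fin N) ℂ) (Φ : Site P i → Matrix (Fin N) (Fin N) ℂ)
    (hdec : ∀ b : PBond P i, Y b = M b + (Φ b.src - ((V b : SU N) : Matrix (Fin N) (Fin N) ℂ) * Φ b.tgt * star ((V b : SU N) : Matrix (Fin N) (Fin N) ℂ)))
    (Y' : PBond P (i + 1) → Matrix (Fin N) (Fin N) ℂ) (hY' : ∀ c : PBond P (i + 1), ‖Y' c - covLinAvgR0 V Y c‖ ≤ r * ‖Y‖) :
    ∃ (M' : PBond P (i + 1) → Matrix (Fin N) (Fin N) ℂ) (Φ' : Site P (i + 1) → Matrix (Fin N) (Fin N) ℂ),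
      (∀ c : PBond P (i + 1), Y' c = M' c + (Φ' c.src - ((avgFun (expMeanLogSU (n := Fin N)) V c : SU N) : Matrix (Fin N) (Fin N) ℂ) * Φ' c.tgt *
        star ((avgFun (expMeanLogSU (n := Fin N)) V c : SU N) : Matrix (Fin N) (Fin N) ℂ))) ∧
      ‖M'‖ ≤ ((P.L : ℝ) + 6 * α * (((P.d + 2) * P.L : ℕ) : ℝ) + r) * ‖M‖ + (6 * α + 2 * r) * ‖Φ‖ ∧
      ‖Φ'‖ ≤ (((P.d + 2) * P.L : ℕ) : ℝ) * ‖M‖ + ‖Φ‖ := by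
  classical
  -- the new gauge function
  refine ⟨fun c => Y' c - ((((Fintype.card (Idx P) : ℂ))⁻¹ • ∑ idx : Idx P, covWalkSum V M (walk (emb c.src) (stairWord idx.2.1 (off idx.1))) + Φ (emb c.src)) -
      ((avgFun (expMeanLogSU (n := Fin N)) V c : SU N) : Matrix (Fin N) (Fin N) ℂ) *
        (((Fintype.card (Idx P) : ℂ))⁻¹ • ∑ idx : Idx P, covWalkSum V M (walk (emb c.tgt) (stairWord idx.2.1 (off idx.1))) + Φ (emb c.tgt)) *
      star ((avgFun (expMeanLogSU (n := Fin N)) V c : SU N) : Matrix (Fin N) (Fin N) ℂ)),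
    fun y => ((Fintype.card (Idx P) : ℂ))⁻¹ • ∑ idx : Idx P, covWalkSum V M (walk (emb y) (stairWord idx.2.1 (off idx.1))) + Φ (emb y),
    fun c => (sub_add_cancel _ _).symm, ?_, ?_⟩
  · -- the remainder bound
    refine (pi_norm_le_iff_of_nonneg (by positivity)).2 fun c => ?_
    have hYle : ‖Y‖ ≤ ‖M‖ + 2 * ‖Φ‖ := by
      refine (pi_norm_le_iff_of_nonneg (by positivity)).2 fun b => ?_
      rw [hdec b]
      exact (norm_add_le _ _).trans (add_le_add (norm_le_pi_norm M b) (norm_covGrad_le V Φ b))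
    have hdecY : Y = M + fun b => Φ b.src - ((V b : SU N) : Matrix (Fin N) (Fin N) ℂ) * Φ b.tgt * star ((V b : SU N) : Matrix (Fin N) (Fin N) ℂ) := by
      funext b; exact hdec b
    have hsplit : covLinAvgR0 V Y c = covLinAvgR0 V M c +
        covLinAvgR0 V (fun b => Φ b.src - ((V b : SU N) : Matrix (Fin N) (Fin N) ℂ) * Φ b.tgt * star ((V b : SU N) : Matrix (Fin N) (Fin N) ℂ)) c := by
      rw [hdecY, covLinAvgR0_add]
    have h1 := hY' c
    have h2 := norm_covLinAvgR0_sub_structure_avgFun_le V M c (hα c) hαδ hα6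
    have h3 := norm_covLinAvgR0_covGrad_sub_le V Φ c (hα c) hαδ hα6
    have h4 := norm_lineMean_le V M c
    have hΦpt : ‖Φ (emb c.tgt)‖ ≤ ‖Φ‖ := norm_le_pi_norm Φ _
    set QM := covLinAvgR0 V M c with hQM
    set QG := covLinAvgR0 V (fun b => Φ b.src - ((V b : SU N) : Matrix (Fin N) (Fin N) ℂ) * Φ b.tgt * star ((V b : SU N) : Matrix (Fin N) (Fin N) ℂ)) c with hQG
    set LMc := ((Fintype.card (Idx P) : ℂ))⁻¹ • ∑ idx : Idx P,
        ((holAt V (walk (emb c.src) (stairWord idx.2.1 (off idx.1))) : SU N) : Matrix (Fin N) (Fin N) ℂ) *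
          covWalkSum V M (walk (walkEnd (emb c.src) (stairWord idx.2.1 (off idx.1))) (List.replicate P.L (c.dir, true))) *
        star ((holAt V (walk (emb c.src) (stairWord idx.2.1 (off idx.1))) : SU N) : Matrix (Fin N) (Fin N) ℂ) with hLMc
    set SMs := ((Fintype.card (Idx P) : ℂ))⁻¹ • ∑ idx : Idx P, covWalkSum V M (walk (emb c.src) (stairWord idx.2.1 (off idx.1))) with hSMs
    set SMt := ((Fintype.card (Idx P) : ℂ))⁻¹ • ∑ idx : Idx P, covWalkSum V M (walk (emb c.tgt) (stairWord idx.2.1 (off idx.1))) with hSMt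
    set u : Matrix (Fin N) (Fin N) ℂ := ((avgFun (expMeanLogSU (n := Fin N)) V c : SU N) : Matrix (Fin N) (Fin N) ℂ) with hu
    have e : Y' c - ((SMs + Φ (emb c.src)) - u * (SMt + Φ (emb c.tgt)) * star u) =
        (Y' c - (QM + QG)) + (QM - (LMc + SMs - u * SMt * star u)) + (QG - (Φ (emb c.src) - u * Φ (emb c.tgt) * star u)) + LMc := by
      noncomm_ring
    rw [e]
    rw [hsplit] at h1
    calc ‖(Y' c - (QM + QG)) + (QM - (LMc + SMs - u * SMt * star u)) + (QG - (Φ (emb c.src) - u * Φ (emb c.tgt) * star u)) + LMc‖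
        ≤ ‖Y' c - (QM + QG)‖ + ‖QM - (LMc + SMs - u * SMt * star u)‖ + ‖QG - (Φ (emb c.src) - u * Φ (emb c.tgt) * star u)‖ + ‖LMc‖ :=
          (norm_add_le _ _).trans (add_le_add ((norm_add_le _ _).trans (add_le_add (norm_add_le _ _) le_rfl)) le_rfl)
      _ ≤ r * ‖Y‖ + 6 * α * ((((P.d + 2) * P.L : ℕ) : ℝ) * ‖M‖) + 6 * α * ‖Φ‖ + (P.L : ℝ) * ‖M‖ :=
          add_le_add (add_le_add (add_le_add h1 h2) (h3.trans (mul_le_mul_of_nonneg_left hΦpt (by positivity)))) h4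
      _ ≤ r * (‖M‖ + 2 * ‖Φ‖) + 6 * α * ((((P.d + 2) * P.L : ℕ) : ℝ) * ‖M‖) + 6 * α * ‖Φ‖ + (P.L : ℝ) * ‖M‖ := by gcongr
      _ = ((P.L : ℝ) + 6 * α * (((P.d + 2) * P.L : ℕ) : ℝ) + r) * ‖M‖ + (6 * α + 2 * r) * ‖Φ‖ := by ring
  · -- the gauge-function bound
    refine (pi_norm_le_iff_of_nonneg (by positivity)).2 fun y => ?_
    exact (norm_add_le _ _).trans (add_le_add (norm_stairMean_le V M y) (norm_le_pi_norm Φ _))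

end Step

section Bootstrap

/-- ★★ **THE BOOTSTRAP**: under the loop `α_i`-guards at every level `i < k` (`0 ≤ α_i ≤ 1∕24`, `α_i < δ_N`), for every `i ≤ k` the level-`i` derivative field
`Y_i = ↑(DΨ_i(0)X)` splits as `M_i + D_{V_i}Φ_i` with `‖M_i‖ ≤ E_i·L^i·‖X‖`, `‖Φ_i‖ ≤ 2(d+2)·E_i·L^i·‖X‖`, `E_i = Π_{j<i}(1 + c₃α_j)`, `c₃ = (d+2)(422 + 1616(d+2))`.
[cite: Balaban1985Averaging, Prop. 3 (124)-(126) p.36, (139)-(147) pp.39-40; Balaban1987RG1, (0.11) p.253] -/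
theorem exists_decomp_fderiv_chartRead_iter (U₀ : GaugeField P 0 (SU N)) (X : PBond P 0 → (specialUnitaryLogChart (Fin N)).lie) {α : ℕ → ℝ}
    (hα0 : ∀ i, 0 ≤ α i) (hα24 : ∀ i, α i ≤ 1 / 24) (hαδ : ∀ i, α i < deltaSU (Fin N)) (k : ℕ)
    (hα : ∀ i, i < k → ∀ (c : PBond P (i + 1)) (idx : Idx P),
      dist1 (loopHol (Averaging.iter (fun i => blockAvg (P := P) (j := i) (expMeanLogSU (n := Fin N))) i U₀) c idx) ≤ α i) :
    ∀ i, i ≤ k → ∃ (M : PBond P i → Matrix (Fin N) (Fin N) ℂ) (Φ : Site P i → Matrix (Fin N) (Fin N) ℂ),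
      (∀ b : PBond P i,
        ((fderiv ℝ (fun (A : PBond P 0 → (specialUnitaryLogChart (Fin N)).lie) (c : PBond P i) =>
            (isChartRep_specialUnitaryGroup (n := Fin N)).logChart
              (Averaging.iter (fun i => blockAvg (P := P) (j := i) (expMeanLogSU (n := Fin N))) i
                  (fun b => (isChartRep_specialUnitaryGroup (n := Fin N)).expChart (A b) * U₀ b) c *
                (Averaging.iter (fun i => blockAvg (P := P) (j := i) (expMeanLogSU (n := Fin N))) i U₀ c)⁻¹)) 0 X b :
            (specialUnitaryLogChart (Fin N)).lie) : Matrix (Fin N) (Fin N) ℂ) =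
          M b + (Φ b.src - ((Averaging.iter (fun i => blockAvg (P := P) (j := i) (expMeanLogSU (n := Fin N))) i U₀ b : SU N) : Matrix (Fin N) (Fin N) ℂ) *
            Φ b.tgt * star ((Averaging.iter (fun i => blockAvg (P := P) (j := i) (expMeanLogSU (n := Fin N))) i U₀ b : SU N) : Matrix (Fin N) (Fin N) ℂ))) ∧
      ‖M‖ ≤ (∏ j ∈ Finset.range i, (1 + ((P.d + 2 : ℕ) : ℝ) * (422 + 1616 * ((P.d + 2 : ℕ) : ℝ)) * α j)) * (P.L : ℝ) ^ i * ‖X‖ ∧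
      ‖Φ‖ ≤ 2 * ((P.d + 2 : ℕ) : ℝ) *
        ((∏ j ∈ Finset.range i, (1 + ((P.d + 2 : ℕ) : ℝ) * (422 + 1616 * ((P.d + 2 : ℕ) : ℝ)) * α j)) * (P.L : ℝ) ^ i * ‖X‖) := by
  -- letters
  set D : ℝ := ((P.d + 2 : ℕ) : ℝ) with hD
  set c₃ : ℝ := D * (422 + 1616 * D) with hc₃
  set E : ℕ → ℝ := fun i => ∏ j ∈ Finset.range i, (1 + c₃ * α j) with hE
  have hD1 : 1 ≤ D := by rw [hD]; exact_mod_cast Nat.le_add_left 1 (P.d + 1)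
  have hD0 : 0 ≤ D := zero_le_one.trans hD1
  have hc₃0 : 0 ≤ c₃ := by rw [hc₃]; positivity
  have hL2 : (2 : ℝ) ≤ (P.L : ℝ) := by exact_mod_cast P.hL.2
  have hL0 : (0 : ℝ) ≤ (P.L : ℝ) := by linarith
  have hℓ : (((P.d + 2) * P.L : ℕ) : ℝ) = D * (P.L : ℝ) := by rw [hD]; push_cast; ring
  have hE1 : ∀ i, 1 ≤ E i := fun i => one_le_prod_one_add hc₃0 hα0 i
  have hEmono : ∀ i, E i ≤ E (i + 1) := fun i => prod_one_add_le_succ hc₃0 hα0 i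
  have hX0 : 0 ≤ ‖X‖ := norm_nonneg X
  intro i
  induction i with
  | zero =>
    intro _
    refine ⟨fun b => ((X b : (specialUnitaryLogChart (Fin N)).lie) : Matrix (Fin N) (Fin N) ℂ), 0, fun b => ?_, ?_, ?_⟩
    · rw [fderiv_chartRead_iter_zero (P := P) (N := N) U₀]
      simp
    · rw [norm_coe_comp_eq]
      show ‖X‖ ≤ E 0 * (P.L : ℝ) ^ 0 * ‖X‖
      rw [hE]; simp
    · rw [norm_zero]; positivity
  | succ i ih =>
    intro hik
    have hi : i < k := Nat.lt_of_succ_le hik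
    obtain ⟨M, Φ, hdec, hM, hΦ⟩ := ih hi.le
    -- guards at level `i`
    have hαi : ∀ (c : PBond P (i + 1)) (idx : Idx P),
        dist1 (loopHol (Averaging.iter (fun i => blockAvg (P := P) (j := i) (expMeanLogSU (n := Fin N))) i U₀) c idx) ≤ α i := hα i hi
    have hα6 : α i ≤ 1 / 6 := (hα24 i).trans (by norm_num)
    have hsb : SmallBelow (fun i => blockAvg (P := P) (j := i) (expMeanLogSU (n := Fin N))) (i + 1) U₀ := by
      intro i' hi' c idx
      exact lt_of_le_of_lt (hα i' (lt_of_lt_of_le hi' hik) c idx) (hαδ i')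
    -- (D0) + (D1): the level-`i+1` field is `Q₁^{R₀}(V_i)(Y_i)` up to `404ℓα_i‖Y_i‖`
    have hstep : ∀ c' : PBond P (i + 1),
        ‖((fderiv ℝ (fun (A : PBond P 0 → (specialUnitaryLogChart (Fin N)).lie) (c' : PBond P (i + 1)) =>
              (isChartRep_specialUnitaryGroup (n := Fin N)).logChart
                (Averaging.iter (fun i => blockAvg (P := P) (j := i) (expMeanLogSU (n := Fin N))) (i + 1)
                    (fun b => (isChartRep_specialUnitaryGroup (n := Fin N)).expChart (A b) * U₀ b) c' *
                  (Averaging.iter (fun i => blockAvg (P := P) (j := i) (expMeanLogSU (n := Fin N))) (i + 1) U₀ c')⁻¹)) 0 X c' :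
              (specialUnitaryLogChart (Fin N)).lie) : Matrix (Fin N) (Fin N) ℂ) -
            covLinAvgR0 (Averaging.iter (fun i => blockAvg (P := P) (j := i) (expMeanLogSU (n := Fin N))) i U₀)
              (fun b => ((fderiv ℝ (fun (A : PBond P 0 → (specialUnitaryLogChart (Fin N)).lie) (c : PBond P i) =>
                  (isChartRep_specialUnitaryGroup (n := Fin N)).logChart
                    (Averaging.iter (fun i => blockAvg (P := P) (j := i) (expMeanLogSU (n := Fin N))) i
                        (fun b => (isChartRep_specialUnitaryGroup (n := Fin N)).expChart (A b) * U₀ b) c *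
                      (Averaging.iter (fun i => blockAvg (P := P) (j := i) (expMeanLogSU (n := Fin N))) i U₀ c)⁻¹)) 0 X b :
                  (specialUnitaryLogChart (Fin N)).lie) : Matrix (Fin N) (Fin N) ℂ)) c'‖ ≤
          404 * (((P.d + 2) * P.L : ℕ) : ℝ) * α i *
            ‖(fun b => ((fderiv ℝ (fun (A : PBond P 0 → (specialUnitaryLogChart (Fin N)).lie) (c : PBond P i) =>
                  (isChartRep_specialUnitaryGroup (n := Fin N)).logChart
                    (Averaging.iter (fun i => blockAvg (P := P) (j := i) (expMeanLogSU (n := Fin N))) i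
                        (fun b => (isChartRep_specialUnitaryGroup (n := Fin N)).expChart (A b) * U₀ b) c *
                      (Averaging.iter (fun i => blockAvg (P := P) (j := i) (expMeanLogSU (n := Fin N))) i U₀ c)⁻¹)) 0 X b :
                  (specialUnitaryLogChart (Fin N)).lie) : Matrix (Fin N) (Fin N) ℂ))‖ := by
      intro c'
      rw [fderiv_chartRead_iter_succ_apply (P := P) (N := N) U₀ i hsb X, norm_coe_comp_eq]
      exact norm_fderiv_chartRead_sub_covLinAvgR0_le (P := P) (N := N) _ hαi (hα24 i) (hαδ i) _ c'
    -- one algebraic step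
    have hr0 : 0 ≤ 404 * (((P.d + 2) * P.L : ℕ) : ℝ) * α i := by have := hα0 i; positivity
    obtain ⟨M', Φ', hdec', hM', hΦ'⟩ := decomp_step (P := P) (N := N) _ hαi (hαδ i) hα6 (hα0 i) hr0 _ M Φ hdec _ hstep
    refine ⟨M', Φ', fun b => hdec' b, ?_, ?_⟩
    · -- arithmetic for `M′`
      refine hM'.trans ?_
      have hαi0 := hα0 i
      have hEi := hE1 i
      set B := E i * (P.L : ℝ) ^ i * ‖X‖ with hB
      have hB0 : 0 ≤ B := by positivity
      have hMB : ‖M‖ ≤ B := hM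
      have hΦB : ‖Φ‖ ≤ 2 * D * B := hΦ
      have hEsucc : E (i + 1) = E i * (1 + c₃ * α i) := by
        show (∏ j ∈ Finset.range (i + 1), (1 + c₃ * α j)) = (∏ j ∈ Finset.range i, (1 + c₃ * α j)) * (1 + c₃ * α i)
        rw [Finset.prod_range_succ]
      show _ ≤ E (i + 1) * (P.L : ℝ) ^ (i + 1) * ‖X‖
      rw [hEsucc, pow_succ, hℓ]
      have hcoef1 : 0 ≤ (P.L : ℝ) + 6 * α i * (D * (P.L : ℝ)) + 404 * (D * (P.L : ℝ)) * α i := by positivity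
      have hcoef2 : 0 ≤ 6 * α i + 2 * (404 * (D * (P.L : ℝ)) * α i) := by positivity
      have hL1 : (1 : ℝ) ≤ (P.L : ℝ) := by linarith
      have h12 : 12 * α i * D ≤ 12 * α i * D * (P.L : ℝ) := le_mul_of_one_le_right (by positivity) hL1
      calc ((P.L : ℝ) + 6 * α i * (D * (P.L : ℝ)) + 404 * (D * (P.L : ℝ)) * α i) * ‖M‖ + (6 * α i + 2 * (404 * (D * (P.L : ℝ)) * α i)) * ‖Φ‖
          ≤ ((P.L : ℝ) + 6 * α i * (D * (P.L : ℝ)) + 404 * (D * (P.L : ℝ)) * α i) * B + (6 * α i + 2 * (404 * (D * (P.L : ℝ)) * α i)) * (2 * D * B) := by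
            gcongr
        _ = B * ((P.L : ℝ) * (1 + α i * (410 * D + 1616 * D * D)) + 12 * α i * D) := by ring
        _ ≤ B * ((P.L : ℝ) * (1 + α i * (410 * D + 1616 * D * D)) + 12 * α i * D * (P.L : ℝ)) := by gcongr
        _ = E i * (1 + c₃ * α i) * ((P.L : ℝ) ^ i * (P.L : ℝ)) * ‖X‖ := by rw [hB, hc₃]; ring
    · -- arithmetic for `Φ′`
      refine hΦ'.trans ?_
      have hαi0 := hα0 i
      have hEi := hE1 i
      set B := E i * (P.L : ℝ) ^ i * ‖X‖ with hB
      have hB0 : 0 ≤ B := by positivity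
      have hMB : ‖M‖ ≤ B := hM
      have hΦB : ‖Φ‖ ≤ 2 * D * B := hΦ
      have hEs : E i ≤ E (i + 1) := hEmono i
      show _ ≤ 2 * D * (E (i + 1) * (P.L : ℝ) ^ (i + 1) * ‖X‖)
      rw [hℓ]
      calc D * (P.L : ℝ) * ‖M‖ + ‖Φ‖ ≤ D * (P.L : ℝ) * B + 2 * D * B := by gcongr
        _ = D * B * ((P.L : ℝ) + 2) := by ring
        _ ≤ D * B * (2 * (P.L : ℝ)) := by
            have : (P.L : ℝ) + 2 ≤ 2 * (P.L : ℝ) := by linarith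
            exact mul_le_mul_of_nonneg_left this (by positivity)
        _ = 2 * D * (E i * (P.L : ℝ) ^ (i + 1) * ‖X‖) := by rw [hB, pow_succ]; ring
        _ ≤ 2 * D * (E (i + 1) * (P.L : ℝ) ^ (i + 1) * ‖X‖) := by gcongr

end Bootstrap

/-! ## §3 ★★★ (D2): the k-step sup bound -/

section KStep

/-- ★★★ **(D2) «WHAT `DM` DOES, k STEPS, IN SUP NORM»**: under the loop `α_i`-guards at every level `i < k` (`0 ≤ α_i ≤ 1∕24`, `α_i < δ_N`), for every direction `X` and coarse bond `B`:
`‖↑((DΨ_k(0) X) B)‖ ≤ (1 + 4(d+2))·Π_{i<k}(1 + c₃α_i)·L^k·‖X‖_∞`, `c₃ = (d+2)(422 + 1616(d+2))`. [cite: Balaban1985Averaging, Prop. 3-4 pp.36-37, (139)-(147) pp.39-40; Balaban1987RG1, (0.11) p.253] -/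
theorem norm_fderiv_chartRead_iter_apply_le (U₀ : GaugeField P 0 (SU N)) (X : PBond P 0 → (specialUnitaryLogChart (Fin N)).lie) {α : ℕ → ℝ}
    (hα0 : ∀ i, 0 ≤ α i) (hα24 : ∀ i, α i ≤ 1 / 24) (hαδ : ∀ i, α i < deltaSU (Fin N)) (k : ℕ)
    (hα : ∀ i, i < k → ∀ (c : PBond P (i + 1)) (idx : Idx P),
      dist1 (loopHol (Averaging.iter (fun i => blockAvg (P := P) (j := i) (expMeanLogSU (n := Fin N))) i U₀) c idx) ≤ α i)
    (B : PBond P k) :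
    ‖((fderiv ℝ (fun (A : PBond P 0 → (specialUnitaryLogChart (Fin N)).lie) (c : PBond P k) =>
          (isChartRep_specialUnitaryGroup (n := Fin N)).logChart
            (Averaging.iter (fun i => blockAvg (P := P) (j := i) (expMeanLogSU (n := Fin N))) k
                (fun b => (isChartRep_specialUnitaryGroup (n := Fin N)).expChart (A b) * U₀ b) c *
              (Averaging.iter (fun i => blockAvg (P := P) (j := i) (expMeanLogSU (n := Fin N))) k U₀ c)⁻¹)) 0 X B :
          (specialUnitaryLogChart (Fin N)).lie) : Matrix (Fin N) (Fin N) ℂ)‖ ≤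
      (1 + 4 * ((P.d + 2 : ℕ) : ℝ)) * (∏ j ∈ Finset.range k, (1 + ((P.d + 2 : ℕ) : ℝ) * (422 + 1616 * ((P.d + 2 : ℕ) : ℝ)) * α j)) *
        (P.L : ℝ) ^ k * ‖X‖ := by
  obtain ⟨M, Φ, hdec, hM, hΦ⟩ := exists_decomp_fderiv_chartRead_iter (P := P) (N := N) U₀ X hα0 hα24 hαδ k hα k le_rfl
  rw [hdec B]
  have h1 : ‖M B‖ ≤ ‖M‖ := norm_le_pi_norm M B
  have h2 := norm_covGrad_le (Averaging.iter (fun i => blockAvg (P := P) (j := i) (expMeanLogSU (n := Fin N))) k U₀) Φ B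
  calc _ ≤ ‖M B‖ + ‖Φ B.src - ((Averaging.iter (fun i => blockAvg (P := P) (j := i) (expMeanLogSU (n := Fin N))) k U₀ B : SU N) : Matrix (Fin N) (Fin N) ℂ) *
        Φ B.tgt * star ((Averaging.iter (fun i => blockAvg (P := P) (j := i) (expMeanLogSU (n := Fin N))) k U₀ B : SU N) : Matrix (Fin N) (Fin N) ℂ)‖ :=
        norm_add_le _ _
    _ ≤ ‖M‖ + 2 * ‖Φ‖ := add_le_add h1 h2
    _ ≤ _ := by
        have hD0 : (0 : ℝ) ≤ ((P.d + 2 : ℕ) : ℝ) := Nat.cast_nonneg _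
        nlinarith [hM, hΦ, norm_nonneg M, norm_nonneg Φ]

/-- ★★★ **(D2), EXPONENTIAL FORM**: `‖↑((DΨ_k(0) X) B)‖ ≤ (1 + 4(d+2))·exp(c₃·Σ_{i<k}α_i)·L^k·‖X‖_∞` — the constant `A = (1 + 4(d+2))·e^{c₃Σα}` is INDEPENDENT OF `k` once
`Σ_{i<k}α_i` is bounded (geometric guards `α_i ≤ cθ_J L^{2(i−k)}` give `Σα_i ≤ cθ_J∕(1 − L⁻²)`). [cite: Balaban1985Averaging, (147) p.40; Balaban1987RG1, (0.11) p.253] -/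
theorem norm_fderiv_chartRead_iter_apply_le_exp (U₀ : GaugeField P 0 (SU N)) (X : PBond P 0 → (specialUnitaryLogChart (Fin N)).lie) {α : ℕ → ℝ}
    (hα0 : ∀ i, 0 ≤ α i) (hα24 : ∀ i, α i ≤ 1 / 24) (hαδ : ∀ i, α i < deltaSU (Fin N)) (k : ℕ)
    (hα : ∀ i, i < k → ∀ (c : PBond P (i + 1)) (idx : Idx P),
      dist1 (loopHol (Averaging.iter (fun i => blockAvg (P := P) (j := i) (expMeanLogSU (n := Fin N))) i U₀) c idx) ≤ α i)
    (B : PBond P k) :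
    ‖((fderiv ℝ (fun (A : PBond P 0 → (specialUnitaryLogChart (Fin N)).lie) (c : PBond P k) =>
          (isChartRep_specialUnitaryGroup (n := Fin N)).logChart
            (Averaging.iter (fun i => blockAvg (P := P) (j := i) (expMeanLogSU (n := Fin N))) k
                (fun b => (isChartRep_specialUnitaryGroup (n := Fin N)).expChart (A b) * U₀ b) c *
              (Averaging.iter (fun i => blockAvg (P := P) (j := i) (expMeanLogSU (n := Fin N))) k U₀ c)⁻¹)) 0 X B :
          (specialUnitaryLogChart (Fin N)).lie) : Matrix (Fin N) (Fin N) ℂ)‖ ≤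
      (1 + 4 * ((P.d + 2 : ℕ) : ℝ)) * Real.exp (((P.d + 2 : ℕ) : ℝ) * (422 + 1616 * ((P.d + 2 : ℕ) : ℝ)) * ∑ j ∈ Finset.range k, α j) *
        (P.L : ℝ) ^ k * ‖X‖ := by
  have hc : (0 : ℝ) ≤ ((P.d + 2 : ℕ) : ℝ) * (422 + 1616 * ((P.d + 2 : ℕ) : ℝ)) := by positivity
  refine (norm_fderiv_chartRead_iter_apply_le (P := P) (N := N) U₀ X hα0 hα24 hαδ k hα B).trans ?_
  have hprod := prod_one_add_le_exp_sum hc hα0 k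
  have hD0 : (0 : ℝ) ≤ ((P.d + 2 : ℕ) : ℝ) := Nat.cast_nonneg _
  gcongr

end KStep

end Summit.QuantumFields.YangMills.Theorems.FluctuationComparisonRegPrIntLS2BetaChartReadDerivKStepSup

end
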